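import Mathlib
import HarnessLib
import Summits.NavierStokesRegularity.NavierStokesRegularity.Theorems.TaylorModelRungThreeCertificateFormatVNode

/-!
# Crux K1b-DR (stmt-NavierStokesRegularity-23954), line `taylor-model` — certificate SOUNDNESS, v3 FRAMES: the
# ENTRYWISE Neumann inverse enclosure `ciBox2` (K-side part of fix (K) of DELTA-ROOM-23954-tm-g4-g9)

WHY (ns-tm-g4 g9, 2026-08-29, memo `certificates/DELTA-ROOM-23954-tm-g4-g9.md`): the uniform enclosure
`ciBox X φ = X ⊕ [−φ·m_c, φ·m_c]` (`m_c = max_r |X r c|`, …IntervalDMatrixBounds) widens EVERY entry of EVERY row by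
`φ·m_c ≈ θ·m_c`, so each transport `|Ci|·ν`, `Ci·Dm`, `(Ci·[M]·B)·Z` of the chain (…FormatVRadii) injects `φ·Σ_b m_b|v_b|`
of the deep-behind rows' (huge but harmless) uncertainty into every ACTIVE row — the «φ-leak floor» measured by cert-1 on
`rp` (j327022) and by tm-g4 g9 on the derivative kernel `[Z]` (≈ 1e-10 per unit-y in every non-active column of every active
row), which makes the (R11N) landing-derivative residual 6·10⁵ × its room on every loop stage.  The ENTRYWISE Neumann bound
below has width `(|I − X·B|·|X|)_{rc} + φ·max_k (|I − X·B|·|X|)_{kc}` at entry `(r,c)`: it VANISHES in every column `c` in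
which `I − X·B` and the off-diagonal part of `X` vanish — e.g. every non-active column once the frame is EXACTLY the identity
off the active block (`maskBlk` below) — so nothing leaks across blocks, while inside the active block it is never wider than
`ciBox` by more than the factor `(1 + θ)`.

CONTENT (pure matrix algebra + array bookkeeping, same style and hypotheses as …FrameNeumann):
* `Matrix.inv_sub_le_entrywise_of_rowSum` — over `Matrix (Fin n) (Fin n) ℝ`: `‖I − XC‖_∞ ≤ θ < 1`, `θ + θφ ≤ φ`,
  `W ≥ |I − XC|·|X|` entrywise with column bounds `W k c ≤ M c` ⇒ `C` is a unit and `|(C⁻¹ − X) i c| ≤ W i c + φ·M c`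
  (proof: `D := C⁻¹ − X = E·X + E·D` with `E := I − XC`; column-wise maximum as in the uniform lemma);
* `absProdUp` (upward `|A|·|B|` for nonnegative dyadic matrices), `ciBox2 n prec X C φ` (the enclosure), `memMat_ciBox2`,
  `exists_inv_of_checkInvFrame2` — SAME test `checkInvFrame`, SAME conclusion shape as `exists_inv_of_checkInvFrame` with
  `ciBox2` in place of `ciBox`;
* `maskBlk` (a frame CHOICE: keep the active × active block of a frame, identity elsewhere — no inclusion claim, the Neumann
  test re-verifies invertibility), `mkNode2` / `nodeOK2` / `exists_inv_of_nodeOK2` — drop-in twins of `mkNode` / `nodeOK` /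
  `exists_inv_of_nodeOK` (…FormatVNode) whose ONLY consumer downstream is `MemMat n g N.Ci`.
Re-pointing `stepNext`/the sub-step/growth runs/closers onto `mkNode2`/`nodeOK2` (new names, append-only) is the chain
owner's (engine-1) N/PN-style rename; this file changes nothing existing.  Cost: one extra `n³` upward dyadic product per node.
References: A. Neumaier, *Interval Methods for Systems of Equations* (1990) §3.6–3.7 (approximate inverses, entrywise
Neumann-series bounds). [folklore]
MODEL-lattice bookkeeping only (rung TL-M3, one finite-dimensional model ODE); nothing here concerns the Navier–Stokes equations.
-/

-- the sub-problem namespace repeats the summit name by design (D-0017)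
set_option linter.dupNamespace false

namespace Summit.NavierStokesRegularity.NavierStokesRegularity.Theorems.TaylorModelCert

open scoped BigOperators
open Matrix

/-! ### The entrywise matrix-algebra lemma over `ℝ` -/

section Real

variable {n : ℕ}

/-- **Entrywise approximate-inverse lemma (Neumann).** If `‖I − X·C‖_∞ ≤ θ < 1` (row sums), `θ + θ·φ ≤ φ`,
`W i c ≥ Σ_j |(I − XC) i j|·|X j c|` and `W k c ≤ M c` for all `k`, then `C` is a unit and
`|(C⁻¹ − X) i c| ≤ W i c + φ · M c` for every entry. [folklore; cite Neumaier 1990 §3.7] -/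
theorem Matrix.isUnit_and_inv_sub_le_entrywise_of_rowSum (X C : Matrix (Fin n) (Fin n) ℝ) {θ φ : ℝ}
    (hE : ∀ i, ∑ j, |(1 - X * C) i j| ≤ θ) (hθ : θ < 1) (hφ : θ + θ * φ ≤ φ)
    {W : Matrix (Fin n) (Fin n) ℝ} (hW : ∀ i c, ∑ j, |(1 - X * C) i j| * |X j c| ≤ W i c)
    {M : Fin n → ℝ} (hM : ∀ k c, W k c ≤ M c) :
    IsUnit C ∧ ∀ i c, |(C⁻¹ - X) i c| ≤ W i c + φ * M c := by
  -- invertibility from the uniform lemma (any column bound of `|X|` will do)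
  have hm : ∀ k c : Fin n, |X k c| ≤ ∑ k', |X k' c| := fun k c =>
    Finset.single_le_sum (f := fun k' => |X k' c|) (fun k' _ => abs_nonneg _) (Finset.mem_univ k)
  obtain ⟨hC, -⟩ := Matrix.isUnit_and_inv_sub_le_of_rowSum X C hE hθ hφ hm
  refine ⟨hC, ?_⟩
  have hCdet : IsUnit C.det := (Matrix.isUnit_iff_isUnit_det C).1 hC
  set E : Matrix (Fin n) (Fin n) ℝ := 1 - X * C with hEdef
  have hrow := Matrix.abs_mulVec_le_of_rowSum E hE
  -- `D := C⁻¹ − X` satisfies `D = E·X + E·D`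
  set D : Matrix (Fin n) (Fin n) ℝ := C⁻¹ - X with hD
  have hDeq : D = E * X + E * D := by
    have h1 : X + D = C⁻¹ := by rw [hD]; abel
    rw [← mul_add, h1, hEdef, sub_mul, one_mul, Matrix.mul_assoc, Matrix.mul_nonsing_inv C hCdet, mul_one]
  -- entrywise: `|D i c| ≤ W i c + θ·max_k |D k c|`
  have hent : ∀ i c, ∀ μ : ℝ, (∀ k, |D k c| ≤ μ) → |D i c| ≤ W i c + θ * μ := by
    intro i c μ hμ
    have e1 : D i c = (∑ j, E i j * X j c) + (E.mulVec fun k => D k c) i := by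
      conv_lhs => rw [hDeq]
      simp [Matrix.add_apply, Matrix.mul_apply, Matrix.mulVec, dotProduct]
    rw [e1]
    refine (abs_add_le _ _).trans (add_le_add ?_ (hrow _ hμ i))
    calc |∑ j, E i j * X j c| ≤ ∑ j, |E i j * X j c| := Finset.abs_sum_le_sum_abs _ _
      _ = ∑ j, |E i j| * |X j c| := by simp only [abs_mul]
      _ ≤ W i c := hW i c
  intro i c
  obtain ⟨i₀, -, hi₀⟩ := Finset.exists_max_image Finset.univ (fun k => |D k c|) ⟨i, Finset.mem_univ i⟩
  have hμ : ∀ k, |D k c| ≤ |D i₀ c| := fun k => hi₀ k (Finset.mem_univ k)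
  have hθ0 : 0 ≤ θ := le_trans (Finset.sum_nonneg fun j _ => abs_nonneg _) (hE i)
  have hMc : 0 ≤ M c := by
    refine le_trans ?_ ((hW i c).trans (hM i c))
    exact Finset.sum_nonneg fun j _ => mul_nonneg (abs_nonneg _) (abs_nonneg _)
  -- the column maximum: `μ ≤ M c + θ μ`, hence `θ μ ≤ φ M c`
  have key : |D i₀ c| ≤ M c + θ * |D i₀ c| := by linarith [hent i₀ c _ hμ, hM i₀ c]
  have h1θ : 0 < 1 - θ := by linarith
  have hθμ : θ * |D i₀ c| ≤ φ * M c := by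
    -- `|D i₀ c| (1 − θ) ≤ M c` and `θ ≤ φ (1 − θ)`
    have h2 : |D i₀ c| * (1 - θ) ≤ M c := by nlinarith [key]
    have h3 : θ ≤ φ * (1 - θ) := by linarith
    have h4 : θ * |D i₀ c| * (1 - θ) ≤ φ * M c * (1 - θ) := by
      calc θ * |D i₀ c| * (1 - θ) = θ * (|D i₀ c| * (1 - θ)) := by ring
        _ ≤ φ * (1 - θ) * M c := mul_le_mul h3 h2 (mul_nonneg (abs_nonneg _) h1θ.le) (by nlinarith)
        _ = φ * M c * (1 - θ) := by ring
    exact le_of_mul_le_mul_right h4 h1θ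
  calc |D i c| ≤ W i c + θ * |D i₀ c| := hent i c _ hμ
    _ ≤ W i c + φ * M c := by linarith [hθμ]

end Real

/-! ### The array-coded enclosure and its soundness in window coordinates -/

section Check

/-- Upward product of two entrywise-NONNEGATIVE dyadic matrices: entry `(r,c) ≥ Σ_{t<n} A r t · B t c`. [folklore] -/
def absProdUp (n prec : ℕ) (A B : Array (Array Dyad)) : Array (Array Dyad) :=
  let BT := transposeD n B
  Array.ofFn (n := n) fun r =>
    let Ar := rowOf A r
    Array.ofFn (n := n) fun c => dotUp prec Ar (rowOf BT c) n

/-- The upward bound `W ≥ |I − X·C|·|X|` used by `ciBox2` (magnitudes of `oneSubMulDD X C` times `|X|`). [folklore] -/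
def neumannW (n prec : ℕ) (X C : Array (Array Dyad)) : Array (Array Dyad) :=
  absProdUp n prec (magM n (oneSubMulDD n prec X C)) (absD n X)

/-- **The ENTRYWISE Neumann enclosure of an inverse near `X`**: entry `(r,c) = X r c ⊕ [−w, w]` with
`w = W r c + φ·max_{k<n} W k c`, `W = neumannW X C`. [folklore] -/
def ciBox2 (n prec : ℕ) (X C : Array (Array Dyad)) (φ : Dyad) : Array (Array IntervalD) :=
  let W := neumannW n prec X C
  let m : Array Dyad := Array.ofFn (n := n) fun c => Dyad.mul φ (colMaxAbs W c n)
  Array.ofFn (n := n) fun r =>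
    ciBoxRow n (rowOf X r) (Array.ofFn (n := n) fun c => Dyad.add (dmget W r c) (dget m c))

variable {n : ℕ} (prec : ℕ)

/-- Entries of `absProdUp` dominate the real products when the factors are dominated entrywise. [folklore] -/
theorem sum_le_absProdUp {A B : Array (Array Dyad)} {x : ℕ → ℕ → ℕ → ℝ}
    (hx : ∀ r < n, ∀ c < n, ∀ t < n, x r c t ≤ dre A r t * dre B t c) {r c : ℕ} (hr : r < n) (hc : c < n) :
    ∑ t ∈ Finset.range n, x r c t ≤ dre (absProdUp n prec A B) r c := by
  simp only [absProdUp, dre, dmget_ofFn_row _ c hr, dget_ofFn _ hc]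
  refine sum_le_dotUp prec (rowOf A r) (rowOf (transposeD n B) c) n fun t ht => ?_
  have e : dget (rowOf (transposeD n B) c) t = dmget B t c := dmget_transposeD B ht hc
  rw [e]
  exact hx r hr c hc t ht

/-- **Membership in `ciBox2`**: a real matrix within `W r c + φ·max_k W k c` of `X` at every entry lies in `ciBox2`. [folklore] -/
theorem memMat_ciBox2 {g : ℕ → ℕ → ℝ} {X C : Array (Array Dyad)} {φ : Dyad}
    (hg : ∀ r < n, ∀ c < n, |g r c - dre X r c| ≤
      dre (neumannW n prec X C) r c + φ.toReal * (colMaxAbs (neumannW n prec X C) c n).toReal) :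
    MemMat n g (ciBox2 n prec X C φ) := by
  intro r hr c hc
  have h := abs_le.1 (hg r hr c hc)
  unfold dre dmget at h
  simp only [ciBox2, ciBoxRow, imget_ofFn_row _ c hr, IntervalD.aget_ofFn _ hc, dget_ofFn _ hc]
  have hdm : (dmget (neumannW n prec X C) r c).toReal = (dget (rowOf (neumannW n prec X C) r) c).toReal := rfl
  refine ⟨?_, ?_⟩
  · simp only [Dyad.toReal_sub, Dyad.toReal_add, Dyad.toReal_mul]
    rw [hdm]; linarith [h.1]
  · simp only [Dyad.toReal_add, Dyad.toReal_mul]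
    rw [hdm]; linarith [h.2]

/-- Range sums as `Fin` sums (bridge to `Matrix`). [folklore] -/
private theorem sum_range_eq_univ' (f : ℕ → ℝ) : ∑ t ∈ Finset.range n, f t = ∑ t : Fin n, f t :=
  Finset.sum_range f

/-- **Soundness of the frame-inverse test, ENTRYWISE enclosure.** If `checkInvFrame n prec X C θ φ` passes, the real
matrix of `C` has a two-sided inverse `g` in window coordinates, and `g ∈ ciBox2 X C φ` entrywise.
[folklore; cite Neumaier 1990 §3.7] -/
theorem exists_inv_of_checkInvFrame2 {X C : Array (Array Dyad)} {θ φ : Dyad}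
    (h : checkInvFrame n prec X C θ φ = true) :
    ∃ g : ℕ → ℕ → ℝ,
      (∀ r < n, ∀ c < n, ∑ t ∈ Finset.range n, dre C r t * g t c = if r = c then 1 else 0) ∧
      (∀ r < n, ∀ c < n, ∑ t ∈ Finset.range n, g r t * dre C t c = if r = c then 1 else 0) ∧
      MemMat n g (ciBox2 n prec X C φ) := by
  have h0 := h
  simp only [checkInvFrame, Bool.and_eq_true] at h
  obtain ⟨⟨hrs, hθ1⟩, hφ⟩ := h
  have hθ : θ.toReal < 1 := by simpa using (Dyad.blt_iff _ _).1 hθ1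
  have hφ' : θ.toReal + θ.toReal * φ.toReal ≤ φ.toReal := by
    simpa [Dyad.toReal_add, Dyad.toReal_mul] using (Dyad.ble_iff _ _).1 hφ
  set Xm : Matrix (Fin n) (Fin n) ℝ := toMat n (dre X) with hXm
  set Cm : Matrix (Fin n) (Fin n) ℝ := toMat n (dre C) with hCm
  -- entries of `I − Xm·Cm` in coordinates, and their enclosure
  have hEmem := memMat_oneSubMulDD (n := n) prec X C
  have hEentry : ∀ (i j : Fin n), (1 - Xm * Cm) i j =
      (if (i : ℕ) = j then (1 : ℝ) else 0) - ∑ t ∈ Finset.range n, dre X i t * dre C t j := by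
    intro i j
    rw [sum_range_eq_univ']
    simp only [Matrix.sub_apply, Matrix.one_apply, Matrix.mul_apply, hXm, hCm, toMat, Matrix.of_apply, Fin.ext_iff]
  have hEabs : ∀ (i j : Fin n), |(1 - Xm * Cm) i j| ≤ dre (magM n (oneSubMulDD n prec X C)) i j := by
    intro i j
    rw [hEentry]
    exact absLeMat_magM hEmem i i.isLt j j.isLt
  -- the row sums of `I − Xm·Cm`
  have hE : ∀ i : Fin n, ∑ j : Fin n, |(1 - Xm * Cm) i j| ≤ θ.toReal := by
    intro i
    have hrow := rowSum_le_of_checkRowSumLe prec hEmem hrs i.isLt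
    rw [sum_range_eq_univ'] at hrow
    refine le_of_eq_of_le (Finset.sum_congr rfl fun j _ => ?_) hrow
    rw [hEentry]
  -- the entrywise product bound `W`
  set Wd := neumannW n prec X C with hWd
  have hW : ∀ i c : Fin n, ∑ j : Fin n, |(1 - Xm * Cm) i j| * |Xm j c| ≤ dre Wd i c := by
    intro i c
    have hs := sum_le_absProdUp (n := n) prec (A := magM n (oneSubMulDD n prec X C)) (B := absD n X)
      (x := fun r c t => |(if r = t then (1 : ℝ) else 0) - ∑ t' ∈ Finset.range n, dre X r t' * dre C t' t| * |dre X t c|)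
      (fun r hr c hc t ht => by
        rw [dre_absD X ht hc]
        exact mul_le_mul_of_nonneg_right (absLeMat_magM hEmem r hr t ht) (abs_nonneg _))
      i.isLt c.isLt
    rw [sum_range_eq_univ'] at hs
    refine le_of_eq_of_le (Finset.sum_congr rfl fun j _ => ?_) hs
    rw [hEentry]
    simp only [hXm, toMat, Matrix.of_apply]
  have hM : ∀ k c : Fin n, dre Wd k c ≤ (colMaxAbs Wd c n).toReal := fun k c =>
    (le_abs_self _).trans (abs_le_colMaxAbs Wd c k.isLt)
  obtain ⟨hC, hbd⟩ := Matrix.isUnit_and_inv_sub_le_entrywise_of_rowSum Xm Cm hE hθ hφ'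
    (W := toMat n (dre Wd)) (fun i c => by simpa [toMat] using hW i c) (M := fun c => (colMaxAbs Wd c n).toReal)
    (fun k c => by simpa [toMat] using hM k c)
  have hCdet : IsUnit Cm.det := (Matrix.isUnit_iff_isUnit_det Cm).1 hC
  -- the inverse in coordinates
  let g : ℕ → ℕ → ℝ := fun r c => if hr : r < n then (if hc : c < n then Cm⁻¹ ⟨r, hr⟩ ⟨c, hc⟩ else 0) else 0
  have hg : ∀ {r c : ℕ} (hr : r < n) (hc : c < n), g r c = Cm⁻¹ ⟨r, hr⟩ ⟨c, hc⟩ := fun hr hc => by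
    simp only [g, dif_pos hr, dif_pos hc]
  refine ⟨g, fun r hr c hc => ?_, fun r hr c hc => ?_, memMat_ciBox2 prec fun r hr c hc => ?_⟩
  · have e := congrFun (congrFun (Matrix.mul_nonsing_inv Cm hCdet) ⟨r, hr⟩) ⟨c, hc⟩
    rw [Matrix.mul_apply] at e
    have e' : ∑ t : Fin n, dre C r t * g t c = ∑ j, Cm ⟨r, hr⟩ j * Cm⁻¹ j ⟨c, hc⟩ :=
      Finset.sum_congr rfl fun t _ => by rw [hg t.isLt hc]; simp [hCm, toMat]
    rw [sum_range_eq_univ', e', e, Matrix.one_apply]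
    simp
  · have e := congrFun (congrFun (Matrix.nonsing_inv_mul Cm hCdet) ⟨r, hr⟩) ⟨c, hc⟩
    rw [Matrix.mul_apply] at e
    have e' : ∑ t : Fin n, g r t * dre C t c = ∑ j, Cm⁻¹ ⟨r, hr⟩ j * Cm j ⟨c, hc⟩ :=
      Finset.sum_congr rfl fun t _ => by rw [hg hr t.isLt]; simp [hCm, toMat]
    rw [sum_range_eq_univ', e', e, Matrix.one_apply]
    simp
  · have hb := hbd ⟨r, hr⟩ ⟨c, hc⟩
    rw [Matrix.sub_apply] at hb
    rw [hg hr hc]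
    simpa [hXm, toMat] using hb

end Check

/-! ### A block frame choice, and the node twins -/

section Node

/-- **Block frame CHOICE**: keep the entries `(r,c)` of `B` with `act r ∧ act c`, identity elsewhere (no inclusion claim —
`checkInvFrame` re-verifies invertibility; with `ciBox2` every column `c` with `act c = false` is then enclosed EXACTLY).
[folklore] -/
def maskBlk (n : ℕ) (act : ℕ → Bool) (B : Array (Array Dyad)) : Array (Array Dyad) :=
  Array.ofFn (n := n) fun r => Array.ofFn (n := n) fun c =>
    if act r && act c then dmget B r c else (if (r : ℕ) = c then Dyad.one else Dyad.zero)

/-- Assemble a node state from `(Vc, e, B, rp, Z)` with the ENTRYWISE inverse enclosure `ciBox2` (twin of `mkNode`).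
[folklore] -/
def mkNode2 (n prec precB : ℕ) (Vc : Array (Array Dyad)) (e : Array Dyad) (B : Array (Array Dyad)) (rp : Array Dyad)
    (Z : Array (Array IntervalD)) : NodeSt :=
  let X := pinvCols n precB B
  let θ := neumannTheta n prec X B
  let φ := neumannPhi θ
  { Vc := Vc, e := e, B := B, X := X, θ := θ, φ := φ, Ci := ciBox2 n prec X B φ, rp := rp, Z := Z }

/-- NODE TEST (twin of `nodeOK`): the Neumann frame-inverse test, consistency of `Ci` with `ciBox2`, and `e, rp ≥ 0`.
[folklore] -/
def nodeOK2 (n prec : ℕ) (N : NodeSt) : Bool :=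
  checkInvFrame n prec N.X N.B N.θ N.φ && decide (N.Ci = ciBox2 n prec N.X N.B N.φ) && nonnegVec n N.e && nonnegVec n N.rp

variable {n : ℕ} (prec : ℕ)

/-- **Soundness of the twin node test** (same conclusion as `exists_inv_of_nodeOK`): a real two-sided inverse of `dre B`
lies in `N.Ci`, and `e, rp ≥ 0`. [folklore] -/
theorem exists_inv_of_nodeOK2 {N : NodeSt} (h : nodeOK2 n prec N = true) :
    (∃ g : ℕ → ℕ → ℝ,
      (∀ r < n, ∀ c < n, ∑ t ∈ Finset.range n, dre N.B r t * g t c = if r = c then 1 else 0) ∧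
      (∀ r < n, ∀ c < n, ∑ t ∈ Finset.range n, g r t * dre N.B t c = if r = c then 1 else 0) ∧
      MemMat n g N.Ci) ∧
    (∀ c < n, 0 ≤ vre N.e c) ∧ (∀ c < n, 0 ≤ vre N.rp c) := by
  simp only [nodeOK2, Bool.and_eq_true, decide_eq_true_eq] at h
  obtain ⟨⟨⟨hinv, hCi⟩, he⟩, hrp⟩ := h
  obtain ⟨g, h1, h2, h3⟩ := exists_inv_of_checkInvFrame2 prec hinv
  rw [← hCi] at h3
  exact ⟨⟨g, h1, h2, h3⟩, fun c hc => nonneg_of_nonnegVec he hc, fun c hc => nonneg_of_nonnegVec hrp hc⟩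

end Node

end Summit.NavierStokesRegularity.NavierStokesRegularity.Theorems.TaylorModelCert
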